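import Literature.Geometry.DiscreteGeometry.KissingRigidity
import Summits.AtomisticToContinuum.Crystallization.Theorems.PalmUnimodularRigidityShellsToBarlowChartCharts

/-!
# Combinatorial layering (B1a of `GapTwelveToBarlow`): the graded chart data of a charted window

Crux `SquareWellLayerCake.GapTwelveToBarlow` (stmt-AtomisticToContinuum-15807), line `Sketch`,
stub `stub_combinatorialLayering`, residual `(H_develop)`.  BRIDGE from the hypotheses of
`(H_develop)` (crux language: integer charts `(T, e)` at the ten-deep sites `j` of an all-Good
`2D`-ball, `dist (x i) (x j) + 10 ≤ 2D`, and the transfer between charts at bonded ten-deep sites —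
supplied by `zchart_of_deep` and `transfers_of_deep`) to the standing hypothesis `hch` of the
transport port (`…CombinatorialLayeringTransportSteps1`): GRADED COMBINATORIAL CHART DATA on the
window.  The sites are the points `x j`; the level-`n` set is
`S n = {x j | dist (x i) (x j) + 10 + n ≤ 2D}` and the bond relation is
`B p q ↔ ∃ j ≠ k, p = x j, q = x k, dist (x j) (x k) ≤ 1` (both nine-deep) — both are ARGUMENTS
characterised by hypotheses `hS`, `hB` (instantiate with the set-builders and `Iff.rfl`), so that
nothing is defined here; the patterns `Pc` and labellings `nb` are produced (by choice) together
with the bundled conclusion CHART ∧ CLOSURE ∧ TRANSFER ∧ SYMMETRY — literally the `hch` of the port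
— and the dictionary `Pc (x j) = image T`, `nb (x j) (T a) = x (e a)` for a chart `(T, e)` at every
ten-deep `j`.  Ingredients: `x` is injective on the Good window (`window_injective`), the label
tables are injective with image `fcc3Int` / `hcpInt` (by `decide`), and the sixteen-case
bookkeeping reducing the transfer clause of `hch` (points of the common closed star given as
centre-or-label on both sides) to the common-neighbour transfer.  All `[folklore]`.
-/

noncomputable section

namespace Summit.AtomisticToContinuum.Crystallization.Theorems.SquareWellLayerCakeGapTwelveToBarlow

open Literature.Geometry.DiscreteGeometry
open Summit.AtomisticToContinuum.Crystallization.Theorems.PalmUnimodularRigidityShellsToBarlowChart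
  (fcc3Int sqNormInt_neg)

/-! ## Tables and injectivity -/

/-- The two label tables are injective. [folklore] -/
theorem zlabelTable_injective {T : Fin 12 → Fin 3 → ℤ} (hT : (T = fun a : Fin 12 => 3 • fccTab a) ∨ T = hcpTab) :
    Function.Injective T := by
  rcases hT with rfl | rfl <;> decide

/-- The two label tables enumerate `fcc3Int` resp. `hcpInt`. [folklore] -/
theorem zlabelTable_image {T : Fin 12 → Fin 3 → ℤ} (hT : (T = fun a : Fin 12 => 3 • fccTab a) ∨ T = hcpTab) :
    Finset.univ.image T = fcc3Int ∨ Finset.univ.image T = hcpInt := by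
  rcases hT with rfl | rfl
  · left; decide
  · right; decide

/-- Labels have squared norm `18`. [folklore] -/
theorem zlabelTable_sqNormInt {T : Fin 12 → Fin 3 → ℤ} (hT : (T = fun a : Fin 12 => 3 • fccTab a) ∨ T = hcpTab)
    (a : Fin 12) : sqNormInt (T a) = 18 := by
  rcases hT with rfl | rfl <;> revert a <;> decide

/-- Distinct labels from squared distance `18`. [folklore] -/
theorem zlabel_ne_of_eighteen {T : Fin 12 → Fin 3 → ℤ} {a b : Fin 12}
    (h : sqNormInt (T a - T b) = 18) : a ≠ b := by
  rintro rfl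
  rw [sub_self] at h
  have h0 : sqNormInt (0 : Fin 3 → ℤ) = 0 := by simp [sqNormInt]
  omega

/-- On an all-Good ball `x` is injective (anchor of this file): a Good site is at distance
`≥ 55/57` from every other site. [folklore] -/
theorem window_injective :
    ∀ {N : ℕ} (x : Fin N → EuclideanSpace ℝ (Fin 3)) (i : Fin N) (D : ℝ), (∀ j : Fin N, dist (x
    i) (x j) ≤ 2 * D → ((∀ j' : Fin N, dist (x j) (x j') ≤ 11 / 10 → ∀ k : Fin N, k ≠ j' → (55 :
    ℝ) / 57 ≤ dist (x j') (x k)) ∧ (Finset.univ.filter fun j' : Fin N => j' ≠ j ∧ dist (x j) (x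
    j') ≤ 1).card = 12 ∧ (Finset.univ.filter fun j' : Fin N => j' ≠ j ∧ dist (x j) (x j') ≤ 11 /
    10).card ≤ 12)) → ∀ {j k : Fin N}, dist (x i) (x j) ≤ 2 * D → x j = x k → j = k := by
  intro N x i D hGood j k hj h
  by_contra hne
  have := (hGood j hj).1 j (by rw [dist_self]; norm_num) k (Ne.symm hne)
  rw [h, dist_self] at this
  norm_num at this

/-! ## The graded data -/

/-- **Graded chart data of a charted window.**  See the module docstring: from integer charts at
the ten-deep sites of an all-Good `2D`-ball and their transfer at bonded pairs, patterns `Pc` and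
labellings `nb` on the points `x j` such that, with the level sets `S` and the bond relation `B`
given by `hS`, `hB`, the bundled hypothesis of the transport port holds, together with the
dictionary at every ten-deep site. [folklore] -/
theorem gradedData_of_charts {N : ℕ} (x : Fin N → EuclideanSpace ℝ (Fin 3)) (i : Fin N) (D : ℝ)
    (hGood : ∀ j : Fin N, dist (x i) (x j) ≤ 2 * D → ((∀ j' : Fin N, dist (x j) (x j') ≤ 11 / 10 → ∀ k : Fin N, k ≠ j' → (55 : ℝ) / 57 ≤ dist (x j') (x k)) ∧ (Finset.univ.filter fun j' : Fin N => j' ≠ j ∧ dist (x j) (x j') ≤ 1).card = 12 ∧ (Finset.univ.filter fun j' : Fin N => j' ≠ j ∧ dist (x j) (x j') ≤ 11 / 10).card ≤ 12))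
    (hCharts : ∀ j : Fin N, dist (x i) (x j) + 10 ≤ 2 * D →
      ∃ (T : Fin 12 → Fin 3 → ℤ) (e : Fin 12 → Fin N), ((((T = fun a : Fin 12 => 3 • fccTab a) ∨ T = hcpTab) ∧ Function.Injective e ∧ (∀ a : Fin 12, e a ≠ j ∧ dist (x j) (x (e a)) ≤ 1) ∧ (∀ k : Fin N, k ≠ j → dist (x j) (x k) ≤ 1 → ∃ a : Fin 12, e a = k) ∧ (∀ a b : Fin 12, a ≠ b → (dist (x (e a)) (x (e b)) ≤ 1 ↔ sqNormInt (T a - T b) = 18)))))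
    (hTransfer : ∀ (j j' : Fin N) (T T' : Fin 12 → Fin 3 → ℤ) (e e' : Fin 12 → Fin N),
      dist (x i) (x j) + 10 ≤ 2 * D → dist (x i) (x j') + 10 ≤ 2 * D → j ≠ j' →
      dist (x j) (x j') ≤ 1 → ((((T = fun a : Fin 12 => 3 • fccTab a) ∨ T = hcpTab) ∧ Function.Injective e ∧ (∀ a : Fin 12, e a ≠ j ∧ dist (x j) (x (e a)) ≤ 1) ∧ (∀ k : Fin N, k ≠ j → dist (x j) (x k) ≤ 1 → ∃ a : Fin 12, e a = k) ∧ (∀ a b : Fin 12, a ≠ b → (dist (x (e a)) (x (e b)) ≤ 1 ↔ sqNormInt (T a - T b) = 18)))) → ((((T' = fun a : Fin 12 => 3 • fccTab a) ∨ T' = hcpTab) ∧ Function.Injective e' ∧ (∀ a : Fin 12, e' a ≠ j' ∧ dist (x j') (x (e' a)) ≤ 1) ∧ (∀ k : Fin N, k ≠ j' → dist (x j') (x k) ≤ 1 → ∃ a : Fin 12, e' a = k) ∧ (∀ a b : Fin 12, a ≠ b → (dist (x (e' a)) (x (e' b)) ≤ 1 ↔ sqNormInt (T' a - T' b) = 18))))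 →
      ∀ a a' b b' : Fin 12, e a = e' b → e a' = e' b' → sqNormInt (T a - T a') = sqNormInt (T' b - T' b'))
    (S : ℕ → Set (EuclideanSpace ℝ (Fin 3)))
    (hS : ∀ (n : ℕ) (p : EuclideanSpace ℝ (Fin 3)),
      p ∈ S n ↔ ∃ j : Fin N, p = x j ∧ dist (x i) (x j) + 10 + n ≤ 2 * D)
    (B : EuclideanSpace ℝ (Fin 3) → EuclideanSpace ℝ (Fin 3) → Prop)
    (hB : ∀ p q : EuclideanSpace ℝ (Fin 3), B p q ↔ ∃ j k : Fin N, p = x j ∧ q = x k ∧ j ≠ k ∧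
      dist (x j) (x k) ≤ 1 ∧ dist (x i) (x j) + 9 ≤ 2 * D ∧ dist (x i) (x k) + 9 ≤ 2 * D) :
    ∃ (Pc : EuclideanSpace ℝ (Fin 3) → Finset (Fin 3 → ℤ)) (nb : EuclideanSpace ℝ (Fin 3) → (Fin
    3 → ℤ) → EuclideanSpace ℝ (Fin 3)), ((∀ n : ℕ, ∀ z ∈ S n, (Pc z = fcc3Int ∨ Pc z = hcpInt) ∧
    Set.BijOn (nb z) (↑(Pc z) : Set (Fin 3 → ℤ)) {y | B z y} ∧ ∀ t ∈ Pc z, ∀ t' ∈ Pc z, (B (nb z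
    t) (nb z t') ↔ sqNormInt (t - t') = 18)) ∧ (∀ n : ℕ, ∀ z ∈ S (n + 1), ∀ y, B z y → y ∈ S n)
    ∧ (∀ n m : ℕ, ∀ p ∈ S n, ∀ q ∈ S m, B p q → ∀ (z z' : EuclideanSpace ℝ (Fin 3)) (t t' u u' :
    Fin 3 → ℤ), (t = 0 ∧ z = p ∨ t ∈ Pc p ∧ z = nb p t) → (t' = 0 ∧ z' = p ∨ t' ∈ Pc p ∧ z' = nb
    p t') → (u = 0 ∧ z = q ∨ u ∈ Pc q ∧ z = nb q u) → (u' = 0 ∧ z' = q ∨ u' ∈ Pc q ∧ z' = nb q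
    u') → sqNormInt (u - u') = sqNormInt (t - t')) ∧ (∀ p q, B p q → B q p)) ∧ (∀ j : Fin N,
    dist (x i) (x j) + 10 ≤ 2 * D → ∃ (T : Fin 12 → Fin 3 → ℤ) (e : Fin 12 → Fin N), ((((T = fun
    a : Fin 12 => 3 • fccTab a) ∨ T = hcpTab) ∧ Function.Injective e ∧ (∀ a : Fin 12, e a ≠ j ∧
    dist (x j) (x (e a)) ≤ 1) ∧ (∀ k : Fin N, k ≠ j → dist (x j) (x k) ≤ 1 → ∃ a : Fin 12, e a =
    k) ∧ (∀ a b : Fin 12, a ≠ b → (dist (x (e a)) (x (e b)) ≤ 1 ↔ sqNormInt (T a - T b) = 18))))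
    ∧ Pc (x j) = Finset.univ.image T ∧ ∀ a : Fin 12, nb (x j) (T a) = x (e a)) := by
  classical
  -- charts as functions of points
  have hCp : ∀ p : EuclideanSpace ℝ (Fin 3), (∃ j : Fin N, p = x j ∧ dist (x i) (x j) + 10 ≤ 2 * D) →
      ∃ (T : Fin 12 → Fin 3 → ℤ) (e : Fin 12 → Fin N) (j : Fin N),
        p = x j ∧ dist (x i) (x j) + 10 ≤ 2 * D ∧
        (((T = fun a : Fin 12 => 3 • fccTab a) ∨ T = hcpTab) ∧ Function.Injective e ∧
          (∀ a : Fin 12, e a ≠ j ∧ dist (x j) (x (e a)) ≤ 1) ∧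
          (∀ k : Fin N, k ≠ j → dist (x j) (x k) ≤ 1 → ∃ a : Fin 12, e a = k) ∧
          (∀ a b : Fin 12, a ≠ b → (dist (x (e a)) (x (e b)) ≤ 1 ↔ sqNormInt (T a - T b) = 18))) := by
    rintro p ⟨j, rfl, hj⟩
    obtain ⟨T, e, h⟩ := hCharts j hj
    exact ⟨T, e, j, rfl, hj, h⟩
  obtain ⟨Pc, hPc⟩ : ∃ Pc : EuclideanSpace ℝ (Fin 3) → Finset (Fin 3 → ℤ), Pc = fun p =>
      if h : ∃ j : Fin N, p = x j ∧ dist (x i) (x j) + 10 ≤ 2 * D then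
        Finset.univ.image (Classical.choose (hCp p h)) else ∅ := ⟨_, rfl⟩
  obtain ⟨nb, hnb⟩ : ∃ nb : EuclideanSpace ℝ (Fin 3) → (Fin 3 → ℤ) → EuclideanSpace ℝ (Fin 3),
      nb = fun p t => if h : ∃ j : Fin N, p = x j ∧ dist (x i) (x j) + 10 ≤ 2 * D then
        (if ht : ∃ a : Fin 12, Classical.choose (hCp p h) a = t then
          x (Classical.choose (Classical.choose_spec (hCp p h)) (Classical.choose ht)) else p)
        else p := ⟨_, rfl⟩
  refine ⟨Pc, nb, ?_⟩
  -- injectivity of `x` on the window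
  have hinjx : ∀ {j k : Fin N}, dist (x i) (x j) ≤ 2 * D → x j = x k → j = k :=
    fun hj h => window_injective x i D hGood hj h
  -- the dictionary at the ten-deep sites
  have key : ∀ j : Fin N, dist (x i) (x j) + 10 ≤ 2 * D →
      ∃ (T : Fin 12 → Fin 3 → ℤ) (e : Fin 12 → Fin N),
        (((T = fun a : Fin 12 => 3 • fccTab a) ∨ T = hcpTab) ∧ Function.Injective e ∧
          (∀ a : Fin 12, e a ≠ j ∧ dist (x j) (x (e a)) ≤ 1) ∧
          (∀ k : Fin N, k ≠ j → dist (x j) (x k) ≤ 1 → ∃ a : Fin 12, e a = k) ∧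
          (∀ a b : Fin 12, a ≠ b → (dist (x (e a)) (x (e b)) ≤ 1 ↔ sqNormInt (T a - T b) = 18))) ∧
        Pc (x j) = Finset.univ.image T ∧ ∀ a : Fin 12, nb (x j) (T a) = x (e a) := by
    intro j hj
    have hex : ∃ j' : Fin N, x j = x j' ∧ dist (x i) (x j') + 10 ≤ 2 * D := ⟨j, rfl, hj⟩
    obtain ⟨T, hT⟩ : ∃ T, Classical.choose (hCp (x j) hex) = T := ⟨_, rfl⟩
    obtain ⟨e, he⟩ : ∃ e, Classical.choose (Classical.choose_spec (hCp (x j) hex)) = e := ⟨_, rfl⟩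
    have aux : ∀ (T₀ : Fin 12 → Fin 3 → ℤ) (e₀ : Fin 12 → Fin N),
        Classical.choose (hCp (x j) hex) = T₀ →
        Classical.choose (Classical.choose_spec (hCp (x j) hex)) = e₀ →
        ∃ j' : Fin N, x j = x j' ∧ dist (x i) (x j') + 10 ≤ 2 * D ∧
          (((T₀ = fun a : Fin 12 => 3 • fccTab a) ∨ T₀ = hcpTab) ∧ Function.Injective e₀ ∧
            (∀ a : Fin 12, e₀ a ≠ j' ∧ dist (x j') (x (e₀ a)) ≤ 1) ∧
            (∀ k : Fin N, k ≠ j' → dist (x j') (x k) ≤ 1 → ∃ a : Fin 12, e₀ a = k) ∧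
            (∀ a b : Fin 12, a ≠ b → (dist (x (e₀ a)) (x (e₀ b)) ≤ 1 ↔ sqNormInt (T₀ a - T₀ b) = 18))) := by
      rintro T₀ e₀ rfl rfl
      exact Classical.choose_spec (Classical.choose_spec (hCp (x j) hex))
    obtain ⟨j', hxj', -, hZ⟩ := aux T e hT he
    have hjj : j = j' := hinjx (by linarith [dist_nonneg (x := x i) (y := x j)]) hxj'
    subst hjj
    refine ⟨T, e, hZ, ?_, ?_⟩
    · rw [hPc]
      dsimp only
      rw [dif_pos hex, hT]
    · intro a
      rw [hnb]
      dsimp only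
      rw [dif_pos hex]
      have ht : ∃ a' : Fin 12, Classical.choose (hCp (x j) hex) a' = T a := ⟨a, by rw [hT]⟩
      rw [dif_pos ht, he]
      have h1 : T (Classical.choose ht) = T a :=
        (congrFun hT (Classical.choose ht)).symm.trans (Classical.choose_spec ht)
      rw [zlabelTable_injective hZ.1 h1]
  -- distance bookkeeping
  have hdeep_nb : ∀ {j k : Fin N}, dist (x i) (x j) + 10 ≤ 2 * D → dist (x j) (x k) ≤ 1 →
      dist (x i) (x k) + 9 ≤ 2 * D := by
    intro j k hj hjk
    linarith [dist_triangle (x i) (x j) (x k)]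
  refine ⟨⟨?_, ?_, ?_, ?_⟩, key⟩
  · -- CHART
    intro n r hr
    obtain ⟨j, rfl, hj⟩ := (hS n r).1 hr
    have hj10 : dist (x i) (x j) + 10 ≤ 2 * D := by linarith [(n.cast_nonneg : (0 : ℝ) ≤ n)]
    obtain ⟨T, e, ⟨hT, hinj, hnbd, hsurj, hiff⟩, hPj, hnbj⟩ := key j hj10
    rw [hPj]
    refine ⟨zlabelTable_image hT, ⟨?_, ?_, ?_⟩, ?_⟩
    · intro t ht
      obtain ⟨a, -, rfl⟩ := Finset.mem_image.1 (Finset.mem_coe.1 ht)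
      show B (x j) (nb (x j) (T a))
      rw [hnbj a, hB]
      exact ⟨j, e a, rfl, rfl, (hnbd a).1.symm, (hnbd a).2, by linarith, hdeep_nb hj10 (hnbd a).2⟩
    · intro t ht t' ht' h
      obtain ⟨a, -, rfl⟩ := Finset.mem_image.1 (Finset.mem_coe.1 ht)
      obtain ⟨a', -, rfl⟩ := Finset.mem_image.1 (Finset.mem_coe.1 ht')
      rw [hnbj, hnbj] at h
      have := hinjx (by linarith [hdeep_nb hj10 (hnbd a).2]) h
      rw [hinj this]
    · intro q hq
      rw [Set.mem_setOf_eq, hB] at hq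
      obtain ⟨j₁, k, hj₁, rfl, hne, hd, -, -⟩ := hq
      have hjj : j = j₁ := hinjx (by linarith) hj₁
      subst hjj
      obtain ⟨a, rfl⟩ := hsurj k hne.symm hd
      exact ⟨T a, Finset.mem_coe.2 (Finset.mem_image.2 ⟨a, Finset.mem_univ _, rfl⟩), hnbj a⟩
    · intro t ht t' ht'
      obtain ⟨a, -, rfl⟩ := Finset.mem_image.1 ht
      obtain ⟨a', -, rfl⟩ := Finset.mem_image.1 ht'
      rw [hnbj, hnbj, hB]
      constructor
      · rintro ⟨j₁, k, h1, h2, hne, hd, -, -⟩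
        have e1 : e a = j₁ := hinjx (by linarith [hdeep_nb hj10 (hnbd a).2]) h1
        have e2 : e a' = k := hinjx (by linarith [hdeep_nb hj10 (hnbd a').2]) h2
        subst e1
        subst e2
        exact (hiff a a' (fun h => hne (by rw [h]))).1 hd
      · intro h18
        have hne := zlabel_ne_of_eighteen h18
        exact ⟨e a, e a', rfl, rfl, fun h => hne (hinj h), (hiff a a' hne).2 h18,
          hdeep_nb hj10 (hnbd a).2, hdeep_nb hj10 (hnbd a').2⟩
  · -- CLOSURE
    intro n r hr q hq
    obtain ⟨j, rfl, hj⟩ := (hS (n + 1) r).1 hr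
    push_cast at hj
    rw [hB] at hq
    obtain ⟨j₁, k, hj₁, rfl, -, hd, -, -⟩ := hq
    have hjj : j = j₁ := hinjx (by linarith) hj₁
    subst hjj
    exact (hS n (x k)).2 ⟨k, rfl, by linarith [dist_triangle (x i) (x j) (x k)]⟩
  · -- TRANSFER
    intro n m p hp q hq hpq z z' t t' u u' hz hz' hu hu'
    obtain ⟨j, rfl, hjn⟩ := (hS n p).1 hp
    obtain ⟨j', rfl, hj'm⟩ := (hS m q).1 hq
    have hj : dist (x i) (x j) + 10 ≤ 2 * D := by linarith [(n.cast_nonneg : (0 : ℝ) ≤ n)]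
    have hj' : dist (x i) (x j') + 10 ≤ 2 * D := by linarith [(m.cast_nonneg : (0 : ℝ) ≤ m)]
    rw [hB] at hpq
    obtain ⟨j₁, k, h1, h2, hne, hd, -, -⟩ := hpq
    have e1 : j = j₁ := hinjx (by linarith) h1
    have e2 : j' = k := hinjx (by linarith) h2
    subst e1
    subst e2
    obtain ⟨T, e, hZ, hPj, hnbj⟩ := key j hj
    obtain ⟨T', e', hZ', hPj', hnbj'⟩ := key j' hj'
    have htr := hTransfer j j' T T' e e' hj hj' hne hd hZ hZ'
    obtain ⟨hT, hinj, hnbd, -, hiff⟩ := hZ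
    obtain ⟨hT', hinj', hnbd', -, hiff'⟩ := hZ'
    have n18 := zlabelTable_sqNormInt hT
    have n18' := zlabelTable_sqNormInt hT'
    -- normal forms of the four descriptions
    have HZ : (t = 0 ∧ z = x j) ∨ ∃ a, t = T a ∧ z = x (e a) := by
      rcases hz with h | ⟨ht, hz⟩
      · exact Or.inl h
      · rw [hPj] at ht
        obtain ⟨a, -, rfl⟩ := Finset.mem_image.1 ht
        exact Or.inr ⟨a, rfl, by rw [hz, hnbj]⟩
    have HZ' : (t' = 0 ∧ z' = x j) ∨ ∃ a, t' = T a ∧ z' = x (e a) := by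
      rcases hz' with h | ⟨ht, hz⟩
      · exact Or.inl h
      · rw [hPj] at ht
        obtain ⟨a, -, rfl⟩ := Finset.mem_image.1 ht
        exact Or.inr ⟨a, rfl, by rw [hz, hnbj]⟩
    have HU : (u = 0 ∧ z = x j') ∨ ∃ b, u = T' b ∧ z = x (e' b) := by
      rcases hu with h | ⟨ht, hz⟩
      · exact Or.inl h
      · rw [hPj'] at ht
        obtain ⟨b, -, rfl⟩ := Finset.mem_image.1 ht
        exact Or.inr ⟨b, rfl, by rw [hz, hnbj']⟩
    have HU' : (u' = 0 ∧ z' = x j') ∨ ∃ b, u' = T' b ∧ z' = x (e' b) := by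
      rcases hu' with h | ⟨ht, hz⟩
      · exact Or.inl h
      · rw [hPj'] at ht
        obtain ⟨b, -, rfl⟩ := Finset.mem_image.1 ht
        exact Or.inr ⟨b, rfl, by rw [hz, hnbj']⟩
    clear hz hz' hu hu'
    -- window bounds for the injectivity of `x`
    have wj : dist (x i) (x j) ≤ 2 * D := by linarith
    have wj' : dist (x i) (x j') ≤ 2 * D := by linarith
    have we : ∀ a, dist (x i) (x (e a)) ≤ 2 * D := fun a => by
      linarith [hdeep_nb hj (hnbd a).2]
    have we' : ∀ b, dist (x i) (x (e' b)) ≤ 2 * D := fun b => by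
      linarith [hdeep_nb hj' (hnbd' b).2]
    -- identification of `z`
    rcases HZ with ⟨rfl, rfl⟩ | ⟨a, rfl, rfl⟩ <;> rcases HU with ⟨rfl, hzz⟩ | ⟨b, rfl, hzz⟩
    · exact (hne (hinjx wj hzz)).elim
    · -- z = x j, labelled `b` at `j'` : `e' b = j`
      have hb : e' b = j := (hinjx wj hzz).symm
      rcases HZ' with ⟨rfl, rfl⟩ | ⟨a', rfl, rfl⟩ <;> rcases HU' with ⟨rfl, hzz'⟩ | ⟨b', rfl, hzz'⟩
      · exact (hne (hinjx wj hzz')).elim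
      · have hb' : e' b' = j := (hinjx wj hzz').symm
        have : b = b' := hinj' (hb.trans hb'.symm)
        subst this
        simp only [sub_self]
      · rw [sub_zero, zero_sub, sqNormInt_neg, n18, n18']
      · have hb' : e' b' = e a' := (hinjx (we a') hzz').symm
        have hbb : b ≠ b' := by
          intro h; apply (hnbd a').1; rw [← hb', ← h, hb]
        rw [zero_sub, sqNormInt_neg, n18]
        apply (hiff' b b' hbb).1
        rw [hb, hb']
        exact (hnbd a').2
    · -- z = x (e a), centre at `j'` : `e a = j'`
      have ha : e a = j' := hinjx (we a) hzz
      rcases HZ' with ⟨rfl, rfl⟩ | ⟨a', rfl, rfl⟩ <;> rcases HU' with ⟨rfl, hzz'⟩ | ⟨b', rfl, hzz'⟩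
      · exact (hne (hinjx wj hzz')).elim
      · rw [zero_sub, sqNormInt_neg, n18', sub_zero, n18]
      · have ha' : e a' = j' := hinjx (we a') hzz'
        have : a = a' := hinj (ha.trans ha'.symm)
        subst this
        simp only [sub_self]
      · have hb' : e' b' = e a' := (hinjx (we a') hzz').symm
        have haa : a ≠ a' := by
          intro h; apply (hnbd' b').1; rw [hb', ← h, ha]
        rw [zero_sub, sqNormInt_neg, n18']
        symm
        apply (hiff a a' haa).1
        rw [ha, ← hb']
        exact (hnbd' b').2
    · -- z = x (e a) = x (e' b)
      have hab : e a = e' b := hinjx (we a) hzz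
      rcases HZ' with ⟨rfl, rfl⟩ | ⟨a', rfl, rfl⟩ <;> rcases HU' with ⟨rfl, hzz'⟩ | ⟨b', rfl, hzz'⟩
      · exact (hne (hinjx wj hzz')).elim
      · have hb' : e' b' = j := (hinjx wj hzz').symm
        have hbb : b ≠ b' := by
          intro h; apply (hnbd a).1; rw [hab, h, hb']
        rw [sub_zero, n18]
        apply (hiff' b b' hbb).1
        rw [← hab, hb', dist_comm]
        exact (hnbd a).2
      · have ha' : e a' = j' := hinjx (we a') hzz'
        have haa : a ≠ a' := by
          intro h; apply (hnbd' b).1; rw [← hab, h, ha']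
        rw [sub_zero, n18']
        symm
        apply (hiff a a' haa).1
        rw [hab, ha', dist_comm]
        exact (hnbd' b).2
      · have hab' : e a' = e' b' := hinjx (we a') hzz'
        exact (htr a a' b b' hab hab').symm
  · -- SYMMETRY
    intro p q h
    rw [hB] at h ⊢
    obtain ⟨j, k, hp, hq, hne, hd, h9, h9'⟩ := h
    exact ⟨k, j, hq, hp, hne.symm, by rw [dist_comm]; exact hd, h9', h9⟩

end Summit.AtomisticToContinuum.Crystallization.Theorems.SquareWellLayerCakeGapTwelveToBarlow

end
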